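import Literature.IUT.HodgeArakelov.CohomologyAmbientRestrict
import Literature.IUT.HodgeArakelov.CohomologyLimitKummer

/-!
# The Kummer map into `lim_K H¹(H ⊓ K, A')` commutes with the restriction of the coefficient AMBIENT (generic)

Generic support piece (abc-iut cell, WAVE-5 seat abc-iut-w5-d169, holder sub-row «P34i-GENUINE-(P1)» of DAG node
IUTchII:Prop3.4(i), `plan/L6/SUBDAG-IUTchII-Prop-31-33-34.md`; GAP row G-w5d169-3): companion of abc-iut-w5-d169's
`CohomologyAmbientRestrict.lean` (p428313: `ContH1Restrict.h1Equiv` / `limEquiv`, restriction of the ambient `G'` of the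
coefficients `A'` to a subgroup `T` with `φ(G) ⊆ T ⊇ A'`) and of abc-iut-w4-d007's `CohomologyLimitKummer.lean`
(p416543: the Kummer map `h1LimKummer c : A →* lim_K H¹(H ⊓ K, A')` of a discrete rootable `Π`-module `A` with cyclotome
coefficients `c : Λ(A) → A'`).  S. Mochizuki, *Inter-universal Teichmüller theory II*, kurims manuscript (Dec. 2020), Prop.
3.1 (ii) p. 88 («`Ψ_cns(M^Θ_*) := M_TM(M^Θ_*) ⊆ lim_J H¹(…)`»); Prop. 1.4 p. 27 (the coefficients «a certain subquotient
`(l·Δ_Θ)(Π)` of `Π`» — intrinsic to `Π`, read in the cell's genuine instantiation inside the larger ambient `(Π^tp_X)^Θ`).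
Claim key `Mochizuki2012` (DISPUTED); classical Kummer theory [cite: NeukirchSchmidtWingberg2008, I §5].

CONSTRUCTED / PROVED (one DATA def, no `Prop`-valued definition, no named fact):
* `ContH1Restrict.coeffRestrict c` — the cyclotome coefficients `Λ(A) → A'.subgroupOf T` read in the smaller ambient
  (`toIn ∘ c`), continuous and `Π`-equivariant for the corestricted `φ`;
* `ContH1Restrict.h1Equiv_kummerContClass` — at every level the restricted-ambient Kummer class is the image of the
  genuine one under `h1Equiv` (same cocycle `h ↦ c((h•x_n/x_n)_n)`);
* **`ContH1Restrict.limEquiv_h1LimKummer`** — `limEquiv (κ_c b) = κ_{c_T} b`: abc-iut-w4-d007's Kummer map into the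
  genuine limit, read at the restricted ambient, IS the Kummer map with the restricted coefficients.
Used by `EtaleThetaDataOfSettingAutActionKummer.lean` to let the Π-INTRINSIC action of `Aut_top(Π^tp_X̲̲)` act on Kummer
classes (binder (P3) of [IUTchII] Prop 3.4 (i)).  Nothing here takes a side on [IUTchIII] Cor. 3.12; typed ≠ proved.
-/

noncomputable section

namespace Literature.IUT.HodgeArakelov

open Literature.AnabelianGeometry.EtaleTheta CohomologySystemOfContH1

namespace ContH1Restrict

section Hom

variable {G' : Type} [Group G'] (A' T : Subgroup G') (hAT : A' ≤ T)

/-- `toIn` as a monoid homomorphism `A' →* A'.subgroupOf T`. [cite: NeukirchSchmidtWingberg2008, I §5] -/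
def toInHom : A' →* A'.subgroupOf T where
  toFun := toIn A' T hAT
  map_one' := toIn_one A' T hAT
  map_mul' := toIn_mul A' T hAT

/-- `toInHom` is `toIn`. [cite: NeukirchSchmidtWingberg2008, I §5] -/
@[simp] theorem toInHom_apply (a : A') : toInHom A' T hAT a = toIn A' T hAT a := rfl

end Hom

section Coeff

variable {G : Type} {G' : Type} [Group G] [TopologicalSpace G] [IsTopologicalGroup G]
  [Group G'] [TopologicalSpace G'] [IsTopologicalGroup G']
  (φ : G →* G') (A' : Subgroup G') [A'.Normal] [IsMulCommutative A']
  (T : Subgroup G') (hT : ∀ g, φ g ∈ T) (hAT : A' ≤ T)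
  {A : Type} [CommGroup A] [MulDistribMulAction G A] [TopologicalSpace A]
  (c : CyclotomeCoefficients φ A' A)

omit [TopologicalSpace G] [IsTopologicalGroup G] [IsTopologicalGroup G'] [IsMulCommutative A'] in
/-- **Cyclotome coefficients read in the smaller ambient**: `Λ(A) → A' → A'.subgroupOf T`, continuous and equivariant
for the corestricted `φ : G → T`. [cite: NeukirchSchmidtWingberg2008, I §5] -/
def coeffRestrict : CyclotomeCoefficients (φ.codRestrict T hT) (A'.subgroupOf T) A where
  hom := (toInHom A' T hAT).comp c.hom
  continuous_hom := (continuous_toIn A' T hAT).comp c.continuous_hom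
  hom_smul g ζ := by
    change toIn A' T hAT (c.hom (g • ζ)) = MulAut.conjNormal (φ.codRestrict T hT g) (toIn A' T hAT (c.hom ζ))
    rw [c.hom_smul]
    exact toIn_conjNormal A' T hAT (φ g) (hT g) _

omit [TopologicalSpace G] [IsTopologicalGroup G] [IsTopologicalGroup G'] [IsMulCommutative A'] in
/-- `coeffRestrict c` on elements, coerced to `G'`: it is `c`. [cite: NeukirchSchmidtWingberg2008, I §5] -/
@[simp] theorem coe_coe_coeffRestrict_hom (ζ : cyclotome A) :
    ((((coeffRestrict φ A' T hT hAT c).hom ζ : A'.subgroupOf T) : T) : G') = (c.hom ζ : G') := rfl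

/-- At every level `H₁`, the Kummer class with restricted coefficients is the image under `h1Equiv` of the genuine
Kummer class (the cocycles are the same function `h ↦ c((h • x_n / x_n)_n)`). [cite: NeukirchSchmidtWingberg2008, I §5] -/
theorem h1Equiv_kummerContClass (H₁ : Subgroup G) {b : A} (x : RootSystem b)
    (hb : b ∈ MulAction.fixedPoints H₁ A) (hx : ∀ n : ℕ+, IsOpen (MulAction.stabilizer G (x.root n) : Set G)) :
    h1Equiv φ A' T hT hAT H₁ (c.kummerContClass H₁ x hb hx) =
      (coeffRestrict φ A' T hT hAT c).kummerContClass H₁ x hb hx := by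
  change QuotientGroup.mk (shrinkCocycle φ A' T hT hAT H₁ (c.kummerContCocycle H₁ x hb hx)) =
    QuotientGroup.mk ((coeffRestrict φ A' T hT hAT c).kummerContCocycle H₁ x hb hx)
  rfl

end Coeff

section Limit

variable {P : TopGroup.{0}} {G' : Type} [Group G'] [TopologicalSpace G'] [IsTopologicalGroup G']
  (φ : P →* G') (A' : Subgroup G') [A'.Normal] [IsMulCommutative A'] (H : Subgroup P)
  (T : Subgroup G') (hT : ∀ g, φ g ∈ T) (hAT : A' ≤ T)
  {A : Type} [CommGroup A] [MulDistribMulAction P A] [TopologicalSpace A] [RootableBy A ℕ]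
  (c : CyclotomeCoefficients φ A' A)
  (hopen : ∀ b : A, IsOpen (MulAction.stabilizer P b : Set P))
  (hfi : ∀ b : A, (MulAction.stabilizer P b).FiniteIndex)

/-- **The Kummer map commutes with the restriction of the ambient**: reading abc-iut-w4-d007's `κ_c b ∈ lim_K H¹(H ⊓ K, A')`
at the ambient `T` (abc-iut-w5-d169's `limEquiv`) gives the Kummer map with coefficients `coeffRestrict c`.
[cite: Mochizuki2012, Prop 3.1 (ii) p.88] -/
theorem limEquiv_h1LimKummer (b : A) :
    limEquiv φ A' H T hT hAT ⊥ (Multiplicative.toAdd (h1LimKummer φ A' H c hopen hfi b)) =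
      Multiplicative.toAdd (h1LimKummer (φ.codRestrict T hT) (A'.subgroupOf T) H (coeffRestrict φ A' T hT hAT c)
        hopen hfi b) := by
  have hb := mem_fixedPoints_stabIdx H hopen hfi b
  rw [h1LimKummer_eq_h1Of_kummerContClass φ A' H c hopen hfi b (stabIdx hopen hfi b) hb (RootSystem.ofRootableBy b),
    h1LimKummer_eq_h1Of_kummerContClass (φ.codRestrict T hT) (A'.subgroupOf T) H (coeffRestrict φ A' T hT hAT c) hopen
      hfi b (stabIdx hopen hfi b) hb (RootSystem.ofRootableBy b),
    toAdd_ofAdd, toAdd_ofAdd, limEquiv_of]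
  rfl

/-- Multiplicative form. [cite: Mochizuki2012, Prop 3.1 (ii) p.88] -/
theorem toMultiplicative_limEquiv_h1LimKummer (b : A) :
    AddEquiv.toMultiplicative (limEquiv φ A' H T hT hAT ⊥) (h1LimKummer φ A' H c hopen hfi b) =
      h1LimKummer (φ.codRestrict T hT) (A'.subgroupOf T) H (coeffRestrict φ A' T hT hAT c) hopen hfi b :=
  congrArg Multiplicative.ofAdd (limEquiv_h1LimKummer φ A' H T hT hAT c hopen hfi b)

end Limit

end ContH1Restrict

end Literature.IUT.HodgeArakelov

end
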